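import Mathlib
import Summits.MatrixMultiplication.MatrixMultiplication.Theses.NOFWindowCapacity

/-!
# Route NOFWindowCapacity — the assembly `Assembly` (stmt-MatrixMultiplication-7280)

Route `MatrixMultiplication/NOFWindowCapacity`, item stmt-MatrixMultiplication-7280 (`Assembly`,
rank 1):

  `PartitionRankBound → Thesis → MatrixMultiplication`.

Proof (pure glue from PROVED tree facts; it is also, verbatim, the type of the route's
kernel-checked deciding theorem
`Summit.MatrixMultiplication.MatrixMultiplication.Theses.NOFWindowCapacity.closes`; the proof here
is self-contained).  Fix `ε > 0`.  `Thesis` at `ε` gives `N ≥ 2`, a finite abelian host `G`, legs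
`s t u : Fin N → G` and `B` alien-free boxes partitioning the `N³` matrix-multiplication triples
with `B·|G| ≤ N^{2+ε}`.  `PartitionRankBound` (Alman–Blasiok 2023, Thm. 32 with `r = R`: linear
accounting) turns the partition into `R(⟨N,N,N⟩) ≤ B·|G|`.  Since `R(⟨N,N,N⟩) ≥ N² ≥ 1`
(flattening bound `matMulTensor_sq_le_tensorRank`), `B·|G| ≥ 1`, so Bläser's interpolation step
(Thm. 5.9, `Blaser2013_logb_mem_admissibleExponents`) makes `log_N (B·|G|)` an admissible exponent,
whence `ω(ℂ) ≤ log_N (B·|G|) ≤ 2 + ε` (`Real.logb_le_iff_le_rpow`, base `N ≥ 2`).  As `ε > 0` was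
arbitrary, `ω(ℂ) ≤ 2`; `ω(ℂ) ≥ 2` is `omega_two_le`, and `MatrixMultiplication_iff`
(`MatrixMultiplication ↔ ω(ℂ) = 2`) closes.

References: J. Alman, J. Błasiok, *Matrix multiplication and number on the forehead
communication*, CCC 2023 (arXiv:2302.11476), §3.9 Thm. 32, §3.10; M. Bläser, *Fast Matrix
Multiplication*, Theory of Computing Graduate Surveys 5 (2013), Thm. 5.9.
-/

namespace Summit.MatrixMultiplication.MatrixMultiplication.Theorems

open Summit.MatrixMultiplication.MatrixMultiplication.Theses.NOFWindowCapacity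
open Literature.Computability.AlgebraicComplexity

/-- The accounting inequality of route NOFWindowCapacity: linear accounting
(`PartitionRankBound`) applied to the alien-free box partition supplied by the entanglement horn
(`Thesis`) at `ε > 0` gives `ω(ℂ) ≤ 2 + ε` — via `R(⟨N,N,N⟩) ≤ B·|G| ≤ N^{2+ε}` and Bläser's
interpolation `R(⟨N,N,N⟩) ≤ q ⇒ ω ≤ log_N q` (`N ≥ 2`, `q ≥ 1`).
[cite: AlmanBlasiok2023, Thm. 32] [cite: Blaser2013, Thm. 5.9] -/
theorem nofWindowCapacity_omega_le_two_add (hP : PartitionRankBound) (hX : Thesis)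
    {ε : ℝ} (hε : 0 < ε) : omega ℂ ≤ 2 + ε := by
  obtain ⟨N, hN, G, instG, instF, s, t, u, B, P, Q, R, hAF, hPart, hB⟩ := hX ε hε
  -- linear accounting: R(⟨N,N,N⟩) ≤ B·|G|
  have hR : tensorRank (matMulTensor ℂ N N N) ≤ B * Fintype.card G :=
    hP N G s t u B P Q R hAF hPart
  have hN1 : 1 < N := hN
  -- B·|G| ≥ 1, since R(⟨N,N,N⟩) ≥ N² ≥ 1 (flattening bound)
  have hq1 : 1 ≤ B * Fintype.card G := by
    have hsq : N ^ 2 ≤ tensorRank (matMulTensor ℂ N N N) := matMulTensor_sq_le_tensorRank ℂ N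
    have hpos : 0 < N ^ 2 := pow_pos (by omega) 2
    omega
  -- Bläser Thm 5.9 interpolation: log_N (B·|G|) is an admissible exponent, hence ≥ ω
  have hmem := Blaser2013_logb_mem_admissibleExponents ℂ hN1 hq1 hR
  have hω : omega ℂ ≤ Real.logb (N : ℝ) ((B * Fintype.card G : ℕ) : ℝ) :=
    csInf_le (admissibleExponents_bddBelow ℂ) hmem
  refine hω.trans ?_
  -- log_N (B·|G|) ≤ 2 + ε from B·|G| ≤ N^(2+ε), N ≥ 2
  have hN1' : (1 : ℝ) < (N : ℝ) := by exact_mod_cast hN1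
  have hq0 : (0 : ℝ) < ((B * Fintype.card G : ℕ) : ℝ) := by exact_mod_cast hq1
  rw [Real.logb_le_iff_le_rpow hN1' hq0]
  exact hB

/-- **Assembly of route NOFWindowCapacity** (item stmt-MatrixMultiplication-7280):
`PartitionRankBound → Thesis → MatrixMultiplication`.  Alien-free box partitions of the
matrix-multiplication support inside abelian group tables with `B·|G| ≤ N^{2+ε}` (the entanglement
horn `Thesis`), priced by linear accounting `R(⟨N,N,N⟩) ≤ B·|G|` (`PartitionRankBound`,
Alman–Blasiok 2023 Thm. 32), give `ω(ℂ) ≤ 2 + ε` for every `ε > 0`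
(`nofWindowCapacity_omega_le_two_add`), hence `ω(ℂ) ≤ 2`; with `ω(ℂ) ≥ 2` (`omega_two_le`,
flattening bound) this is `ω(ℂ) = 2`, i.e. `MatrixMultiplication` (`MatrixMultiplication_iff`).
The statement is literally the type of the route's deciding theorem
`Theses.NOFWindowCapacity.closes`; the proof here is self-contained.
[cite: AlmanBlasiok2023, Thm. 32] [cite: Blaser2013, Thm. 5.9] -/
theorem nofWindowCapacity_assembly_proof :
    Summit.MatrixMultiplication.MatrixMultiplication.Theses.NOFWindowCapacity.Assembly := by
  unfold Summit.MatrixMultiplication.MatrixMultiplication.Theses.NOFWindowCapacity.Assembly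
  intro hP hX
  rw [_root_.MatrixMultiplication_iff]
  refine le_antisymm ?_ (omega_two_le ℂ)
  exact le_of_forall_pos_le_add fun ε hε => nofWindowCapacity_omega_le_two_add hP hX hε

end Summit.MatrixMultiplication.MatrixMultiplication.Theorems
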